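import Summits.QuantumFields.YangMills.Theorems.ColdStartUniversalityColdStartSolutionsExistTruncatedBounds
import HarnessLib

/-!
# Route `ColdStartUniversality`, support item S (stmt-QuantumFields-24811), line `piwiener`:
# stub C — the radially truncated SZZ coefficients are tame, tangent, and agree with (⋆) on the group

Helper file (lead `ym-line-csu-p1`) — **proves the registered stub C `stub_truncatedCoefficients` of the
skeleton `Cruxes/ColdStartSolutionsExist/Lines/piwiener.lean`** (statement unfolded:
`exists_truncatedCoefficients`; general-`r` form `exists_truncatedCoefficients_rep` for every lattice
representation of degree `N ≤ 3`): the modified system `b̃_e(Q) = driftLie β (t ∘ Q) e · t(Q_e) + C_𝔤 Q_e`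
(`t` the radial truncation at Frobenius radius `√3` of `…TruncatedBounds`), `σ̃ = σ`, is TAME
(squared-Frobenius globally Lipschitz with `K = (|β|(6·4·3^{3/2}·3·√3 + 6·9·3) + ‖C_𝔤‖_F)² + 2`, and maps
`V_r^E = (span_ℝ ρ(G))^E` into `V_r`, p601845), TANGENT (`2⟨b̃_e,Q_e⟩ + Σₙ‖σ_{e,n}‖² = 0`, `⟨σ_{e,n},Q_e⟩ = 0`,
p601845), and AGREES with (⋆) on `ρ(G)`-valued configurations (`‖ρ(g)‖_F² = N ≤ 3`).

No definition, no sorry, standard axioms.  RECORD-rung plumbing; nothing here bears on the mass gap.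
-/

set_option autoImplicit false

noncomputable section

namespace Summit.QuantumFields.YangMills.Theorems.ColdStartUniversality

open Matrix Complex Finset
open scoped ComplexConjugate BigOperators Matrix.Norms.Frobenius
open Literature.MathematicalPhysics.QuantumFieldTheory

/-! ### Stub C: the truncated SZZ system for `SU(2)` -/

section StubC

open Literature.MathematicalPhysics.QuantumLattice (fundamentalRep fundamentalLatticeRep)

variable {G : Type*} [Group G] [TopologicalSpace G] {L N : ℕ}

/-- A link of a configuration differs from the corresponding link of another by at most the
`ℓ²`-over-links distance `δ = (Σ_e' ‖Q e' − Q' e'‖²)^{1/2}`. [folklore] -/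
theorem norm_sub_apply_le_sqrt_sum [NeZero L] (Q Q' : MatrixConfig 3 L N) (x : Edge 3 L) :
    ‖Q x - Q' x‖ ≤ Real.sqrt (∑ e', ‖Q e' - Q' e'‖ ^ 2) := by
  refine Real.le_sqrt_of_sq_le ?_
  exact Finset.single_le_sum (f := fun e' => ‖Q e' - Q' e'‖ ^ 2) (fun _ _ => by positivity)
    (Finset.mem_univ x)

/-- **Stub C, for any lattice representation of degree `N ≤ 3`**: there is a link SDE `S̃` on
`M_N(ℂ)^E` — the SZZ system (⋆) for `r` with the plaquette arguments and the factor `Q_e` of the `𝔤`-drift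
radially truncated at Frobenius radius `√3`, noise and Casimir term unchanged — which is TAME
(squared-Frobenius globally Lipschitz drift and noise; coefficients map `V_r^E = (span_ℝ ρ(G))^E` into
`V_r`), TANGENT (`2⟨b̃_e, Q_e⟩ + Σₙ ‖σ_{e,n}‖² = 0`, `⟨σ_{e,n}, Q_e⟩ = 0`), and AGREES with (⋆) on every
`G`-valued configuration (there all `‖Q_e‖_F² = N ≤ 3`, so the truncation is the identity). -/
theorem exists_truncatedCoefficients_rep (r : LatticeRep G) (hN : (r.N : ℝ) ≤ 3) (L : ℕ) [NeZero L]
    (β : ℝ) :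
    ∃ S : LinkSDE 3 L r.N (NoiseIdx r.N),
      ((∃ K : ℝ, ∀ (Q Q' : MatrixConfig 3 L r.N) (e : Edge 3 L),
          hsForm r.N (S.drift Q e - S.drift Q' e) (S.drift Q e - S.drift Q' e) ≤
              K * ∑ e', hsForm r.N (Q e' - Q' e') (Q e' - Q' e') ∧
            ∀ n, hsForm r.N (S.noise Q e n - S.noise Q' e n) (S.noise Q e n - S.noise Q' e n) ≤
              K * ∑ e', hsForm r.N (Q e' - Q' e') (Q e' - Q' e')) ∧
        ∀ Q : MatrixConfig 3 L r.N,
          (∀ e, Q e ∈ Submodule.span ℝ (Set.range (r.ρ : G → Matrix (Fin r.N) (Fin r.N) ℂ))) →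
          ∀ e, S.drift Q e ∈ Submodule.span ℝ (Set.range (r.ρ : G → Matrix (Fin r.N) (Fin r.N) ℂ)) ∧
            ∀ n, S.noise Q e n ∈ Submodule.span ℝ (Set.range (r.ρ : G → Matrix (Fin r.N) (Fin r.N) ℂ))) ∧
      (∀ (Q : MatrixConfig 3 L r.N) (e : Edge 3 L),
        2 * hsForm r.N (S.drift Q e) (Q e) + ∑ n, hsForm r.N (S.noise Q e n) (S.noise Q e n) = 0 ∧
          ∀ n, hsForm r.N (S.noise Q e n) (Q e) = 0) ∧
      ∀ (U : GaugeConfig 3 L G) (e : Edge 3 L),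
        S.drift (matrixConfig r.ρ U) e = (latticeLangevinDynamics r β).drift (matrixConfig r.ρ U) e ∧
          ∀ n, S.noise (matrixConfig r.ρ U) e n = (latticeLangevinDynamics r β).noise (matrixConfig r.ρ U) e n := by
  -- the truncation and the modified system
  let t : Matrix (Fin r.N) (Fin r.N) ℂ → Matrix (Fin r.N) (Fin r.N) ℂ := fun M => ((3 : ℝ) / max (hsForm r.N M M) 3) • M
  let S : LinkSDE 3 L r.N (NoiseIdx r.N) :=
    { drift := fun Q e => r.driftLie β (fun e' => t (Q e')) e * t (Q e) + r.casimir * Q e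
      noise := (latticeLangevinDynamics r β).noise }
  have hSd : ∀ Q e, S.drift Q e = r.driftLie β (fun e' => t (Q e')) e * t (Q e) + r.casimir * Q e :=
    fun _ _ => rfl
  have hSn : ∀ Q e n, S.noise Q e n = (latticeLangevinDynamics r β).noise Q e n := fun _ _ _ => rfl
  have ht : ∀ M, t M = ((3 : ℝ) / max (hsForm r.N M M) 3) • M := fun _ => rfl
  -- constants
  set s : ℝ := Real.sqrt 3 with hs
  have hs0 : 0 ≤ s := Real.sqrt_nonneg _
  set K₀ : ℝ := |β| * (6 * (4 * s ^ 3 * 3)) * s + |β| * (6 * s ^ 4) * 3 + ‖r.casimir‖ with hK₀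
  have hK₀0 : 0 ≤ K₀ := by positivity
  refine ⟨S, ⟨⟨K₀ ^ 2 + 2, fun Q Q' e => ?_⟩, fun Q hQ e => ⟨?_, fun n => ?_⟩⟩, fun Q e => ⟨?_, fun n => ?_⟩,
    fun U e => ⟨?_, fun n => rfl⟩⟩
  · -- Lipschitz
    set δ : ℝ := Real.sqrt (∑ e', ‖Q e' - Q' e'‖ ^ 2) with hδ
    have hδ0 : 0 ≤ δ := Real.sqrt_nonneg _
    have hδx : ∀ x, ‖Q x - Q' x‖ ≤ δ := norm_sub_apply_le_sqrt_sum Q Q'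
    have hδsq : δ ^ 2 = ∑ e', hsForm r.N (Q e' - Q' e') (Q e' - Q' e') := by
      rw [hδ, Real.sq_sqrt (Finset.sum_nonneg fun _ _ => by positivity)]
      simp_rw [hsForm_sub_self_eq_norm_sq]
    have hsum0 : 0 ≤ ∑ e', hsForm r.N (Q e' - Q' e') (Q e' - Q' e') := by rw [← hδsq]; positivity
    -- the truncated links
    have hR : ∀ x, ‖t (Q x)‖ ≤ s := fun x => norm_trunc_le (Q x)
    have hR' : ∀ x, ‖t (Q' x)‖ ≤ s := fun x => norm_trunc_le (Q' x)
    have hRR' : ∀ x, ‖t (Q x) - t (Q' x)‖ ≤ 3 * δ := fun x =>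
      (norm_trunc_sub_trunc_le (Q x) (Q' x)).trans (by linarith [hδx x])
    constructor
    · -- drift
      have hA := norm_driftLie_sub_le r β hs0 (by positivity : (0 : ℝ) ≤ 3 * δ) hR hR' hRR' e
      have hA' := norm_driftLie_le r β hs0 hR' e
      have hid : S.drift Q e - S.drift Q' e =
          (r.driftLie β (fun e' => t (Q e')) e - r.driftLie β (fun e' => t (Q' e')) e) * t (Q e) +
            r.driftLie β (fun e' => t (Q' e')) e * (t (Q e) - t (Q' e)) + r.casimir * (Q e - Q' e) := by
        rw [hSd, hSd]; noncomm_ring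
      have hnorm : ‖S.drift Q e - S.drift Q' e‖ ≤ K₀ * δ := by
        rw [hid]
        calc _ ≤ ‖(r.driftLie β (fun e' => t (Q e')) e - r.driftLie β (fun e' => t (Q' e')) e) * t (Q e)‖ +
              ‖r.driftLie β (fun e' => t (Q' e')) e * (t (Q e) - t (Q' e))‖ + ‖r.casimir * (Q e - Q' e)‖ := by
              refine (norm_add_le _ _).trans ?_
              gcongr
              exact norm_add_le _ _
          _ ≤ |β| * (6 * (4 * s ^ 3 * (3 * δ))) * s + |β| * (6 * s ^ 4) * (3 * δ) + ‖r.casimir‖ * δ := by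
              gcongr
              · exact (norm_mul_le _ _).trans (by gcongr; exact hR e)
              · exact (norm_mul_le _ _).trans (by gcongr; exact hRR' e)
              · exact (norm_mul_le _ _).trans (by gcongr; exact hδx e)
          _ = K₀ * δ := by rw [hK₀]; ring
      rw [hsForm_sub_self_eq_norm_sq, ← hδsq]
      have hsq : ‖S.drift Q e - S.drift Q' e‖ ^ 2 ≤ (K₀ * δ) ^ 2 :=
        pow_le_pow_left₀ (norm_nonneg _) hnorm 2
      nlinarith [sq_nonneg δ]
    · -- noise
      intro n
      have hid : S.noise Q e n - S.noise Q' e n =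
          ((Real.sqrt 2 : ℝ) : ℂ) • (r.lieProj (noiseDir n) * (Q e - Q' e)) := by
        rw [hSn, hSn, latticeLangevinDynamics_noise, latticeLangevinDynamics_noise, ← smul_sub,
          ← Matrix.mul_sub]
      have hnorm : ‖S.noise Q e n - S.noise Q' e n‖ ≤ Real.sqrt 2 * δ := by
        rw [hid, norm_smul, Complex.norm_real, Real.norm_eq_abs, abs_of_nonneg (Real.sqrt_nonneg _)]
        gcongr
        calc ‖r.lieProj (noiseDir n) * (Q e - Q' e)‖ ≤ ‖r.lieProj (noiseDir n)‖ * ‖Q e - Q' e‖ :=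
              norm_mul_le _ _
          _ ≤ 1 * δ := by
              gcongr
              · exact norm_lieProj_noiseDir_le r n
              · exact hδx e
          _ = δ := one_mul δ
      rw [hsForm_sub_self_eq_norm_sq, ← hδsq]
      have hsq : ‖S.noise Q e n - S.noise Q' e n‖ ^ 2 ≤ (Real.sqrt 2 * δ) ^ 2 :=
        pow_le_pow_left₀ (norm_nonneg _) hnorm 2
      rw [mul_pow, Real.sq_sqrt (by norm_num : (0:ℝ) ≤ 2)] at hsq
      nlinarith [sq_nonneg δ, sq_nonneg K₀]
  · -- drift maps V^E into V
    rw [hSd]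
    exact Submodule.add_mem _
      (mul_mem_spanRange r (driftLie_mem_spanRange r β _ e) (Submodule.smul_mem _ _ (hQ e)))
      (mul_mem_spanRange r (casimir_mem_spanRange r) (hQ e))
  · -- noise maps V^E into V
    rw [hSn]
    exact noise_mem_spanRange r β Q e n (hQ e)
  · -- tangency of the drift (Itô-corrected)
    rw [hSd]
    simp_rw [hSn]
    exact two_hsForm_drift_add_sum_noise_sq_eq_zero r β Q e (r.driftLie_mem_lieAlg β _ e) _
  · -- tangency of the noise
    rw [hSn]
    exact hsForm_noise_self r β Q e n
  · -- agreement on SU(2)-valued configurations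
    have hunit : ∀ x, t (matrixConfig r.ρ U x) = matrixConfig r.ρ U x := by
      intro x
      rw [ht]
      refine trunc_eq_self_of_le ?_
      have h2 : hsForm r.N (matrixConfig r.ρ U x) (matrixConfig r.ρ U x) = r.N :=
        hsForm_self_rho r (U x)
      rw [h2]; exact hN
    have hcfg : (fun e' => t (matrixConfig r.ρ U e')) = matrixConfig r.ρ U :=
      funext hunit
    rw [hSd, hcfg, hunit, latticeLangevinDynamics_drift, Matrix.add_mul]


/-- **Stub C of the `piwiener` line** (`__Registered.stub_truncatedCoefficients`, unfolded; `SU(2)` in the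
fundamental representation, `N = 2 ≤ 3`). -/
theorem exists_truncatedCoefficients (L : ℕ) [NeZero L] (β : ℝ) :
    ∃ S : LinkSDE 3 L 2 (NoiseIdx 2),
      ((∃ K : ℝ, ∀ (Q Q' : MatrixConfig 3 L 2) (e : Edge 3 L),
          hsForm 2 (S.drift Q e - S.drift Q' e) (S.drift Q e - S.drift Q' e) ≤
              K * ∑ e', hsForm 2 (Q e' - Q' e') (Q e' - Q' e') ∧
            ∀ n, hsForm 2 (S.noise Q e n - S.noise Q' e n) (S.noise Q e n - S.noise Q' e n) ≤
              K * ∑ e', hsForm 2 (Q e' - Q' e') (Q e' - Q' e')) ∧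
        ∀ Q : MatrixConfig 3 L 2, (∀ e, Q e ∈ Submodule.span ℝ (Set.range (fundamentalRep (Fin 2)))) →
          ∀ e, S.drift Q e ∈ Submodule.span ℝ (Set.range (fundamentalRep (Fin 2))) ∧
            ∀ n, S.noise Q e n ∈ Submodule.span ℝ (Set.range (fundamentalRep (Fin 2)))) ∧
      (∀ (Q : MatrixConfig 3 L 2) (e : Edge 3 L),
        2 * hsForm 2 (S.drift Q e) (Q e) + ∑ n, hsForm 2 (S.noise Q e n) (S.noise Q e n) = 0 ∧
          ∀ n, hsForm 2 (S.noise Q e n) (Q e) = 0) ∧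
      ∀ (U : GaugeConfig 3 L (Matrix.specialUnitaryGroup (Fin 2) ℂ)) (e : Edge 3 L),
        S.drift (matrixConfig (fundamentalRep (Fin 2)) U) e =
            (latticeLangevinDynamics (fundamentalLatticeRep 2) β).drift
              (matrixConfig (fundamentalRep (Fin 2)) U) e ∧
          ∀ n, S.noise (matrixConfig (fundamentalRep (Fin 2)) U) e n =
            (latticeLangevinDynamics (fundamentalLatticeRep 2) β).noise
              (matrixConfig (fundamentalRep (Fin 2)) U) e n :=
  exists_truncatedCoefficients_rep (fundamentalLatticeRep 2) (by norm_num) L β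

end StubC

end Summit.QuantumFields.YangMills.Theorems.ColdStartUniversality

end
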